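import Summits.QuantumFields.BalabanUV.Beta.GAN24.CoProjSlotCharges
import Summits.QuantumFields.BalabanUV.Beta.GAN24.LinT2CoDressed
import Summits.QuantumFields.BalabanUV.Beta.GAN24.WSlotFirstDiff

/-!
# `BalabanUV.Beta.GAN24.TableDressingZeroMode` — binder row G-an2-4 ∕ (CONV-C), W-slot CT-route «CT-W» (the row owner gan24-p1 g23's W3 re-cut of (R-CT),
# journal l.37785, item (W3)(b) «zero-charge lemma»; leaf-02 g52's located finding F-leaf02-g52-1, l.37867): **THE FIELD–FIELD ZERO MODE OF THE
# LEG-DRESSED TABLE `𝔇 Y` IS `N⁴` TIMES THE FOUR-FACE CHARGE OF `Y`** — `𝔇` (leaf-06 g42's `LinT2CoDressed.lin4_coDressKBmAt`: `Πᵀ_bm` on both source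
# slots, `Π_bm ∘ · ∘ Πᵀ_bm` on the kernel legs) does NOT preserve `BiStencilZeroMode.zmode`; it reads the table on the configurations whose four bonds all
# cross a block face in their own direction

NOT IN PRINT; OUR BOOKKEEPING (G-an2-4 crux team (2), leaf prover `b2b-balaban-gan24-formalise-leaf-02`, gen 52; journal [LEAF02-G52-ONLINE] ∕ INTENT
[LEAF02-G52-INTENT1] l.37867; PART 2 of the kernel certificate of the finding — PART 1 = `GAN24/CoProjSlotCharges`).  WHY IT MATTERS: the owner's W3 re-cut
of (R-CT) writes every contact cell as `𝒜^B_l ((𝔇 − 1) T̃_l)` and proposed (W3)(b) «`ZfreeSym Y → ZfreeSym ((𝔇 − 1) Y)`» as the marginality check «as ONE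
identity»; by the theorem below `zmode N ((𝔇 − 1) Y) = N⁴·fourFace_N (Y) − zmode N Y`, and `ZfreeSym Y` constrains the second term only — the lemma is FALSE
as stated; what the tables must satisfy instead is a FACE identity (p2 g35's (F2) «face-weighted (Q-lin)» in table form).  PRIOR ART BY NAME, nothing
re-derived: the four one-variable read-outs are PART 1 (`CoProjSlotCharges`, over gan24-p4's `PiBmConstants` §3–§4), the `LocStencil₂` bookkeeping of the
two slot dressings is leaf-06 g42's `LinT2CoDressed.locStencil₂_coProj_snd ∕ _fst`, the product summability is leaf-06's `KernelLegCharges.summable_prod_of_biLoc`,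
`zmode` ∕ `Tab` are leaf-02 g15's `BiStencilZeroMode`.  HONEST FRAMING (cell contract, verbatim): «discharging `BetaPertH` makes Bałaban's UV stability
UNCONDITIONAL — a real constructive-QFT result; it is NOT the continuum limit and NOT the Clay problem.»  HONEST DEPENDENCY (verbatim): «continuum YM on T⁴ ⇐
BetaPertH ∧ nine spine estimates (0/9 proved); BetaPertH ⇐ (D1) ∧ (D4) ∧ CAP+tail; G-an2-4 gates asym, D1 and NE2/3/4.»  [folklore] lattice-sum bookkeeping;
generic dimension `d+1`, `1 ≤ N`, in-block root `ρ = toSite r`; 0 `def`, 0 cited facts, 0 `def … : Prop`, 0 sorry.  NO estimate of Bałaban's; discharges NOTHING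
of (hW, hWall) ∕ «T2Shape» ∕ «T2Drift»; 0 wall binders; NEVER «G-an2-4 closed» as (CONV-C); NOT D1, NOT BetaPertH, NOT continuum, NOT Clay.

## What (`ρ = toSite r`, `r ∈ box (d+1) N`, `1 ≤ N`; `Y : Tab d` with `LocStencil₂ Y C δ`, `0 < δ`)
* §1 summability: `summable_ite_of_summable`, `summable_triple` (a `LocStencil₂` slice is absolutely summable in (second bond, both legs) jointly),
  `summable_faceSum` (its face-masked leg double sum is summable in the second bond).
* §2 the one-variable read-outs inside the table: `tsum_tsum_face_coProjBmAtK` (a masked leg double sum commutes with the window dressing of a source slot),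
  `tsum_faceSum_coProj_snd` (second source slot: `Σ'_{u′} (masked legs of Πᵀ_2 Y) = N·Σ'_{u′ at κ′-face} (masked legs of Y)`), `faceSum_periodic` (the
  face-masked reduced one-form of a jointly `N`-covariant table is `N`-periodic).
* §3 **`zmode_tableDress_ff`**: for jointly `N`-covariant `Y`,
  `zmode N (𝔇 Y) κ κ′ (inl a) (inl b) = N⁴ · Σ_{r′ ∈ box} Σ'_{u′} Σ'_x Σ'_z (if (toSite r′)_κ, u′_{κ′}, x_a, z_b all ≡ N−1 (mod N) then Y κ (toSite r′) κ′ u′ x z (inl a) (inl b) else 0)`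
  with `𝔇 Y κ u κ′ u′ := dressKBmAt ρ N (coProjBmAtK ρ N (fun κ₁ u₁ ↦ coProjBmAtK ρ N (Y κ₁ u₁) κ′ u′) κ u)` VERBATIM the table of `lin4_coDressKBmAt`.
* §4 **`zmode_tableDress_sub_self_ff`**: the (W3)(b) object itself (the `LocStencil₂` letter of `𝔇 Y` is leaf-06 g43's `TableDressingDefect.locStencil₂_tableDress`, inlined here) —
  `zmode N (𝔇 Y − Y) κ κ′ (inl a) (inl b) = N⁴·(four-face charge) − zmode N Y κ κ′ (inl a) (inl b)` (leaf-19's `WSlotFirstDiff.zmode_sub`).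
-/

noncomputable section

open Finset
open scoped BigOperators
open Literature.MathematicalPhysics.QuantumFieldTheory
open Literature.MathematicalPhysics.QuantumFieldTheory.Balaban1983to89
open Literature.MathematicalPhysics.QuantumFieldTheory.Balaban1983to89.Beta
open B12Sec2to5 (l1 l1_nonneg)
open ExpKernelCalculus (MKer BiLoc shiftK summable_exp_shift')
open AffineAveraging (Form1 Site box toSite)
open OneStepResolventKernel (Fib)
open BalabanCompositeJets (LocStencil₂)
open Summit.QuantumFields.BalabanUV.Beta.AxialDressingRooted (pmBm cube coProjBmAt coProjBmAt_apply coProjBmAtK coProjBmAtK_eval dressKBmAt cWb cKb)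
open Summit.QuantumFields.BalabanUV.Beta.GAN24.BiStencilZeroMode (Tab zmode)
open Summit.QuantumFields.BalabanUV.Beta.GAN24.KernelLegCharges (summable_prod_of_biLoc)
open Summit.QuantumFields.BalabanUV.Beta.GAN24.LinT2CoDressed (locStencil₂_coProj_snd locStencil₂_coProj_fst locStencil₂_dress)
open Summit.QuantumFields.BalabanUV.Beta.GAN24.WSlotFirstDiff (zmode_sub)
open Summit.QuantumFields.BalabanUV.Beta.GAN24.CoProjSlotCharges (tsum_coProjBmAt_eq_face sum_box_coProjBmAt_eq_face_of_periodic
  tsum_tsum_dressKBmAt_inl_inl_eq_face)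

namespace Summit.QuantumFields.BalabanUV.Beta.GAN24.TableDressingZeroMode

variable {d : ℕ} {N : ℕ} {r : Fin (d + 1) → ℕ}

/-! ## §1 Summability of the slices of a `LocStencil₂` table -/

/-- [folklore] Masking a summable real family by a decidable predicate keeps it summable. -/
theorem summable_ite_of_summable {ι : Type*} {f : ι → ℝ} (hf : Summable f) (P : ι → Prop) [DecidablePred P] :
    Summable fun i => if P i then f i else 0 := by
  refine Summable.of_norm_bounded hf.abs fun i => ?_
  rw [Real.norm_eq_abs]
  split_ifs
  · exact le_rfl
  · rw [abs_zero]; exact abs_nonneg _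

/-- [folklore] A masked series is the series of the mask inside (trivial case split). -/
theorem ite_tsum {ι : Type*} (P : Prop) [Decidable P] (f : ι → ℝ) :
    (if P then ∑' i, f i else 0) = ∑' i, (if P then f i else 0) := by
  by_cases h : P
  · simp only [if_pos h]
  · simp only [if_neg h, tsum_zero]

/-- [folklore] **A SLICE OF A `LocStencil₂` TABLE IS ABSOLUTELY SUMMABLE IN (SECOND BOND, FIRST LEG, SECOND LEG) JOINTLY** (rate `δ > 0`; dominated by
`C·e^{−δ|u′−u|}·e^{−δ|x−u|}·e^{−δ|z−u|}`). -/
theorem summable_triple {X : Tab d} {C δ : ℝ} (hX : LocStencil₂ X C δ) (hδ : 0 < δ) (κ : Fin (d + 1)) (u : Site (d + 1)) (κ' : Fin (d + 1))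
    (a b : Fib d) :
    Summable fun p : Site (d + 1) × (Site (d + 1) × Site (d + 1)) => X κ u κ' p.1 p.2.1 p.2.2 a b := by
  have h1 : Summable fun u' : Site (d + 1) => Real.exp (-δ * l1 (u' - u)) := summable_exp_shift' hδ u
  have h23 : Summable fun xz : Site (d + 1) × Site (d + 1) => Real.exp (-δ * l1 (xz.1 - u)) * Real.exp (-δ * l1 (xz.2 - u)) :=
    h1.mul_of_nonneg h1 (fun _ => (Real.exp_pos _).le) (fun _ => (Real.exp_pos _).le)
  have h123 : Summable fun p : Site (d + 1) × (Site (d + 1) × Site (d + 1)) =>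
      Real.exp (-δ * l1 (p.1 - u)) * (Real.exp (-δ * l1 (p.2.1 - u)) * Real.exp (-δ * l1 (p.2.2 - u))) :=
    h1.mul_of_nonneg h23 (fun _ => (Real.exp_pos _).le) (fun _ => mul_nonneg (Real.exp_pos _).le (Real.exp_pos _).le)
  refine Summable.of_norm_bounded (h123.mul_left C) fun p => ?_
  rw [Real.norm_eq_abs]
  calc |X κ u κ' p.1 p.2.1 p.2.2 a b|
      ≤ C * Real.exp (-δ * l1 (p.1 - u)) * Real.exp (-δ * (l1 (p.2.1 - u) + l1 (p.2.2 - u))) := hX κ u κ' p.1 p.2.1 p.2.2 a b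
    _ = C * (Real.exp (-δ * l1 (p.1 - u)) * (Real.exp (-δ * l1 (p.2.1 - u)) * Real.exp (-δ * l1 (p.2.2 - u)))) := by
        rw [mul_add, Real.exp_add]; ring

/-- [folklore] The leg pair of one slice entry is summable on the product lattice (leaf-06's `summable_prod_of_biLoc`). -/
theorem summable_legs {X : Tab d} {C δ : ℝ} (hX : LocStencil₂ X C δ) (hδ : 0 < δ) (κ : Fin (d + 1)) (u : Site (d + 1)) (κ' : Fin (d + 1))
    (u' : Site (d + 1)) (a b : Fib d) :
    Summable fun xz : Site (d + 1) × Site (d + 1) => X κ u κ' u' xz.1 xz.2 a b :=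
  summable_prod_of_biLoc (hX κ u κ' u') hδ a b

/-- [folklore] **THE FACE-MASKED LEG DOUBLE SUM OF A SLICE IS SUMMABLE IN THE SECOND BOND** (any mask on the legs). -/
theorem summable_faceSum {X : Tab d} {C δ : ℝ} (hX : LocStencil₂ X C δ) (hδ : 0 < δ) (κ : Fin (d + 1)) (u : Site (d + 1)) (κ' : Fin (d + 1))
    (a b : Fib d) (P : Site (d + 1) → Site (d + 1) → Prop) [∀ x z, Decidable (P x z)] :
    Summable fun u' : Site (d + 1) => ∑' x : Site (d + 1), ∑' z : Site (d + 1), (if P x z then X κ u κ' u' x z a b else 0) := by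
  have h3 := summable_ite_of_summable (summable_triple hX hδ κ u κ' a b) (fun p => P p.2.1 p.2.2)
  have h := h3.prod
  refine h.congr fun u' => ?_
  exact (h3.prod_factor u').tsum_prod

/-! ## §2 The one-variable read-outs inside the table -/

/-- [folklore] **A MASKED LEG DOUBLE SUM COMMUTES WITH THE WINDOW DRESSING OF A SOURCE SLOT**: for a stencil-slot family `S` with summable leg pairs,
`Σ'_x Σ'_z [P x z]·(coProjBmAtK ρ N S κ₀ u₀) x z a b = coProjBmAt ρ N (fun β′ u₂ ↦ Σ'_x Σ'_z [P x z]·S β′ u₂ x z a b) κ₀ u₀` (finite window sum out of the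
two series). -/
theorem tsum_tsum_face_coProjBmAtK (ρ : Fin (d + 1) → ℤ) (N : ℕ) {S : Fin (d + 1) → Site (d + 1) → MKer (d + 1) (Fib d)} (a b : Fib d)
    (hS : ∀ β' u₂, Summable fun xz : Site (d + 1) × Site (d + 1) => S β' u₂ xz.1 xz.2 a b)
    (P : Site (d + 1) → Site (d + 1) → Prop) [∀ x z, Decidable (P x z)] (κ₀ : Fin (d + 1)) (u₀ : Site (d + 1)) :
    ∑' x : Site (d + 1), ∑' z : Site (d + 1), (if P x z then coProjBmAtK ρ N S κ₀ u₀ x z a b else 0)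
      = coProjBmAt ρ N (fun β' u₂ => ∑' x : Site (d + 1), ∑' z : Site (d + 1), (if P x z then S β' u₂ x z a b else 0)) κ₀ u₀ := by
  have e1 : ∀ x z : Site (d + 1), (if P x z then coProjBmAtK ρ N S κ₀ u₀ x z a b else 0)
      = ∑ v ∈ cube (d + 1) N, ∑ β' : Fin (d + 1), pmBm ρ N β' (u₀ + v) κ₀ u₀ * (if P x z then S β' (u₀ + v) x z a b else 0) := by
    intro x z
    rw [coProjBmAtK_eval, coProjBmAt_apply]
    split_ifs
    · rfl
    · simp
  have hm : ∀ (v : Site (d + 1)) (β' : Fin (d + 1)), Summable fun xz : Site (d + 1) × Site (d + 1) =>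
      pmBm ρ N β' (u₀ + v) κ₀ u₀ * (if P xz.1 xz.2 then S β' (u₀ + v) xz.1 xz.2 a b else 0) :=
    fun v β' => (summable_ite_of_summable (hS β' (u₀ + v)) (fun xz => P xz.1 xz.2)).mul_left _
  simp_rw [e1]
  have ez : ∀ x : Site (d + 1), ∑' z : Site (d + 1), ∑ v ∈ cube (d + 1) N, ∑ β' : Fin (d + 1),
        pmBm ρ N β' (u₀ + v) κ₀ u₀ * (if P x z then S β' (u₀ + v) x z a b else 0)
      = ∑ v ∈ cube (d + 1) N, ∑ β' : Fin (d + 1), ∑' z : Site (d + 1), pmBm ρ N β' (u₀ + v) κ₀ u₀ * (if P x z then S β' (u₀ + v) x z a b else 0) := by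
    intro x
    rw [Summable.tsum_finsetSum fun v _ => summable_sum fun β' _ => (hm v β').prod_factor x]
    exact Finset.sum_congr rfl fun v _ => Summable.tsum_finsetSum fun β' _ => (hm v β').prod_factor x
  simp_rw [ez]
  rw [Summable.tsum_finsetSum fun v _ => summable_sum fun β' _ => (hm v β').prod]
  have ex : ∀ v ∈ cube (d + 1) N, ∑' x : Site (d + 1), ∑ β' : Fin (d + 1), ∑' z : Site (d + 1),
        pmBm ρ N β' (u₀ + v) κ₀ u₀ * (if P x z then S β' (u₀ + v) x z a b else 0)
      = ∑ β' : Fin (d + 1), pmBm ρ N β' (u₀ + v) κ₀ u₀ * ∑' x : Site (d + 1), ∑' z : Site (d + 1), (if P x z then S β' (u₀ + v) x z a b else 0) := by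
    intro v _
    rw [Summable.tsum_finsetSum fun β' _ => (hm v β').prod]
    refine Finset.sum_congr rfl fun β' _ => ?_
    simp_rw [tsum_mul_left]
  rw [Finset.sum_congr rfl ex, coProjBmAt_apply]

/-- NOT IN PRINT; OUR BOOKKEEPING.  **THE SECOND SOURCE SLOT READ BY ITS TOTAL** (`LocStencil₂` table, `δ > 0`, in-block root, `1 ≤ N`; any leg mask `P`):
`Σ'_{u′} Σ'_x Σ'_z [P]·(coProjBmAtK ρ N (Y β p) κ′ u′) x z a b = N · Σ'_{u′} [u′_{κ′} % N = N−1]·Σ'_x Σ'_z [P]·Y β p κ′ u′ x z a b` — the window dressing of the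
second slot commutes with the masked leg sums (`tsum_tsum_face_coProjBmAtK`) and PART 1's `tsum_coProjBmAt_eq_face` reads the slot total. -/
theorem tsum_faceSum_coProj_snd (hN : 1 ≤ N) (hr : r ∈ box (d + 1) N) {Y : Tab d} {C δ : ℝ} (hY : LocStencil₂ Y C δ) (hδ : 0 < δ)
    (β : Fin (d + 1)) (p : Site (d + 1)) (κ' : Fin (d + 1)) (a b : Fib d) (P : Site (d + 1) → Site (d + 1) → Prop) [∀ x z, Decidable (P x z)] :
    ∑' u' : Site (d + 1), ∑' x : Site (d + 1), ∑' z : Site (d + 1), (if P x z then coProjBmAtK (toSite r) N (Y β p) κ' u' x z a b else 0)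
      = (N : ℝ) * ∑' u' : Site (d + 1), (if u' κ' % (N : ℤ) = (N : ℤ) - 1 then
          ∑' x : Site (d + 1), ∑' z : Site (d + 1), (if P x z then Y β p κ' u' x z a b else 0) else 0) := by
  have e1 : ∀ u' : Site (d + 1), ∑' x : Site (d + 1), ∑' z : Site (d + 1), (if P x z then coProjBmAtK (toSite r) N (Y β p) κ' u' x z a b else 0)
      = coProjBmAt (toSite r) N (fun β' u₂ => ∑' x : Site (d + 1), ∑' z : Site (d + 1), (if P x z then Y β p β' u₂ x z a b else 0)) κ' u' :=
    fun u' => tsum_tsum_face_coProjBmAtK (toSite r) N a b (fun β' u₂ => summable_legs hY hδ β p β' u₂ a b) P κ' u'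
  simp_rw [e1]
  exact tsum_coProjBmAt_eq_face hN hr (g := fun β' u₂ => ∑' x : Site (d + 1), ∑' z : Site (d + 1), (if P x z then Y β p β' u₂ x z a b else 0))
    (fun β' => summable_faceSum hY hδ β p β' a b P) κ'

/-- [folklore] Face conditions are invariant under coarse shifts: `(q + N•t)_α % N = q_α % N`. -/
theorem face_shift (N : ℕ) (q t : Site (d + 1)) (α : Fin (d + 1)) :
    (q + (N : ℤ) • t) α % (N : ℤ) = q α % (N : ℤ) := by
  rw [Pi.add_apply, Pi.smul_apply, smul_eq_mul, Int.add_mul_emod_self_left]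

/-- NOT IN PRINT; OUR BOOKKEEPING.  **THE FACE-MASKED REDUCED ONE-FORM OF A JOINTLY `N`-COVARIANT TABLE IS `N`-PERIODIC**: with
`Ψ β q := Σ'_{u′} [u′_{κ′} face]·Σ'_x Σ'_z [x_a, z_b faces]·Y β q κ′ u′ x z a′ b′` and `Y κ (u + N•t) κ′ (u′ + N•t) = shiftK (−N•t) (Y κ u κ′ u′)`,
`Ψ β (q + N•t) = Ψ β q` (re-index the three series by `+N•t`; the face conditions are coarse-shift invariant). -/
theorem faceSum_periodic (N : ℕ) {Y : Tab d}
    (hcov : ∀ κ u κ' u' t, Y κ (u + (N : ℤ) • t) κ' (u' + (N : ℤ) • t) = shiftK (-((N : ℤ) • t)) (Y κ u κ' u'))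
    (κ' : Fin (d + 1)) (a b : Fin (d + 1)) (a' b' : Fib d) (β : Fin (d + 1)) (q t : Site (d + 1)) :
    (∑' u' : Site (d + 1), (if u' κ' % (N : ℤ) = (N : ℤ) - 1 then
        ∑' x : Site (d + 1), ∑' z : Site (d + 1),
          (if x a % (N : ℤ) = (N : ℤ) - 1 ∧ z b % (N : ℤ) = (N : ℤ) - 1 then Y β (q + (N : ℤ) • t) κ' u' x z a' b' else 0) else 0))
      = ∑' u' : Site (d + 1), (if u' κ' % (N : ℤ) = (N : ℤ) - 1 then
        ∑' x : Site (d + 1), ∑' z : Site (d + 1),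
          (if x a % (N : ℤ) = (N : ℤ) - 1 ∧ z b % (N : ℤ) = (N : ℤ) - 1 then Y β q κ' u' x z a' b' else 0) else 0) := by
  set v : Site (d + 1) := (N : ℤ) • t with hv
  -- re-index the second bond
  rw [← (Equiv.addRight v).tsum_eq (fun u' : Site (d + 1) => (if u' κ' % (N : ℤ) = (N : ℤ) - 1 then
        ∑' x : Site (d + 1), ∑' z : Site (d + 1),
          (if x a % (N : ℤ) = (N : ℤ) - 1 ∧ z b % (N : ℤ) = (N : ℤ) - 1 then Y β (q + v) κ' u' x z a' b' else 0) else 0))]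
  refine tsum_congr fun u' => ?_
  simp only [Equiv.coe_addRight]
  rw [hv, face_shift N u' t κ', hcov β q κ' u' t]
  by_cases hu : u' κ' % (N : ℤ) = (N : ℤ) - 1
  · rw [if_pos hu, if_pos hu]
    -- re-index the first leg
    rw [← (Equiv.addRight v).tsum_eq (fun x : Site (d + 1) => ∑' z : Site (d + 1),
          (if x a % (N : ℤ) = (N : ℤ) - 1 ∧ z b % (N : ℤ) = (N : ℤ) - 1 then shiftK (-((N : ℤ) • t)) (Y β q κ' u') x z a' b' else 0))]
    refine tsum_congr fun x => ?_
    simp only [Equiv.coe_addRight]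
    -- re-index the second leg
    rw [← (Equiv.addRight v).tsum_eq (fun z : Site (d + 1) =>
          (if (x + v) a % (N : ℤ) = (N : ℤ) - 1 ∧ z b % (N : ℤ) = (N : ℤ) - 1 then shiftK (-((N : ℤ) • t)) (Y β q κ' u') (x + v) z a' b' else 0))]
    refine tsum_congr fun z => ?_
    simp only [Equiv.coe_addRight]
    rw [hv, face_shift N x t a, face_shift N z t b]
    simp only [shiftK, add_neg_cancel_right]
  · rw [if_neg hu, if_neg hu]

/-! ## §3 The zero mode of the leg-dressed table -/

/-- NOT IN PRINT; OUR BOOKKEEPING.  **THE FIELD–FIELD ZERO MODE OF THE LEG-DRESSED TABLE IS `N⁴` TIMES THE FOUR-FACE CHARGE** (in-block root `ρ = toSite r`,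
`1 ≤ N`; `Y : Tab d` with `LocStencil₂ Y C δ`, `0 < δ`, jointly `N`-covariant): with leaf-06 g42's table dressing
`𝔇 Y κ u κ′ u′ := dressKBmAt ρ N (coProjBmAtK ρ N (fun κ₁ u₁ ↦ coProjBmAtK ρ N (Y κ₁ u₁) κ′ u′) κ u)` (VERBATIM the table of `LinT2CoDressed.lin4_coDressKBmAt`:
`lin4 c (coDressKBmAt ρ N K) N Y = lin4 c K N (𝔇 Y)`),
`zmode N (𝔇 Y) κ κ′ (inl a) (inl b) = N⁴ · Σ_{r′ ∈ box} Σ'_{u′} Σ'_x Σ'_z (if (toSite r′)_κ % N = N−1 ∧ u′_{κ′} % N = N−1 ∧ x_a % N = N−1 ∧ z_b % N = N−1 then Y κ (toSite r′) κ′ u′ x z (inl a) (inl b) else 0)`.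
Each of the four `Πᵀ_bm`-dressings inside `𝔇` is read by the total over ITS OWN variable through the ROW sums of the matrix of `Π_bm` (`⟨1_α, Πᵀ_bm g⟩ = ⟨Π_bm 1_α, g⟩ =
N·(α-face sum)`): the two kernel legs by PART 1's `tsum_tsum_dressKBmAt_inl_inl_eq_face` (= gan24-p4's `PiBmConstants.tsum_prod_dressKBmAt_inl_inl`), the second source
slot by `tsum_faceSum_coProj_snd`, the cell-restricted first source slot by PART 1's `sum_box_coProjBmAt_eq_face_of_periodic` on the `N`-periodic reduced one-form
(`faceSum_periodic`).  CONSEQUENCE: `zmode N ((𝔇 − 1) Y) = N⁴·fourFace_N (Y) − zmode N Y` — `ZfreeSym Y` does NOT imply `ZfreeSym ((𝔇 − 1) Y)`; the dressing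
preserves the cell charge of `Y` iff `Y`'s four-face charge is `N^{−4}` of its full charge (a face identity of the TABLE, not of `𝔇`). -/
theorem zmode_tableDress_ff (hN : 1 ≤ N) (hr : r ∈ box (d + 1) N) {Y : Tab d} {C δ : ℝ} (hY : LocStencil₂ Y C δ) (hδ : 0 < δ)
    (hcov : ∀ κ u κ' u' t, Y κ (u + (N : ℤ) • t) κ' (u' + (N : ℤ) • t) = shiftK (-((N : ℤ) • t)) (Y κ u κ' u'))
    (κ κ' a b : Fin (d + 1)) :
    zmode N (fun κ u κ' u' => dressKBmAt (toSite r) N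
        (coProjBmAtK (toSite r) N (fun κ₁ u₁ => coProjBmAtK (toSite r) N (Y κ₁ u₁) κ' u') κ u)) κ κ' (Sum.inl a) (Sum.inl b)
      = (N : ℝ) ^ 4 * ∑ r' ∈ box (d + 1) N, ∑' u' : Site (d + 1), ∑' x : Site (d + 1), ∑' z : Site (d + 1),
          (if toSite r' κ % (N : ℤ) = (N : ℤ) - 1 ∧ u' κ' % (N : ℤ) = (N : ℤ) - 1 ∧ x a % (N : ℤ) = (N : ℤ) - 1 ∧ z b % (N : ℤ) = (N : ℤ) - 1
            then Y κ (toSite r') κ' u' x z (Sum.inl a) (Sum.inl b) else 0) := by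
  -- the slot-2-dressed table `V` and the doubly slot-dressed table `W`, with their `LocStencil₂` letters (leaf-06 g42)
  set V : Tab d := fun κ₁ u₁ κ₂ u₂ => coProjBmAtK (toSite r) N (Y κ₁ u₁) κ₂ u₂ with hV
  set W : Tab d := fun κ₀ u₀ κ₂ u₂ => coProjBmAtK (toSite r) N (fun κ₁ u₁ => V κ₁ u₁ κ₂ u₂) κ₀ u₀ with hW
  have hVloc : LocStencil₂ V (cKb d N δ * C) δ := locStencil₂_coProj_snd hN hr hY hδ.le
  have hWloc : LocStencil₂ W (cWb d N * Real.exp (3 * δ * (((d : ℝ) + 1) * N)) * (cKb d N δ * C)) δ :=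
    locStencil₂_coProj_fst hN hr hVloc hδ.le
  -- the face masks
  set fxz : Site (d + 1) → Site (d + 1) → Prop := fun x z => x a % (N : ℤ) = (N : ℤ) - 1 ∧ z b % (N : ℤ) = (N : ℤ) - 1 with hfxz
  -- the face-masked reduced one-form of `Y` (second bond and both legs summed, face-masked)
  set Ψ : Form1 (d + 1) ℝ := fun β p => ∑' u' : Site (d + 1), (if u' κ' % (N : ℤ) = (N : ℤ) - 1 then
      ∑' x : Site (d + 1), ∑' z : Site (d + 1), (if fxz x z then Y β p κ' u' x z (Sum.inl a) (Sum.inl b) else 0) else 0) with hΨ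
  -- STEP 0: unfold `zmode`; the dressed table's slice is `dressKBmAt ρ N (W κ q′ κ′ u′)`
  show ∑ r' ∈ box (d + 1) N, ∑' u' : Site (d + 1), ∑' x : Site (d + 1), ∑' z : Site (d + 1),
      dressKBmAt (toSite r) N (W κ (toSite r') κ' u') x z (Sum.inl a) (Sum.inl b) = _
  -- STEP 1 (kernel legs): `Σ'_x Σ'_z dress(W…) = N²·Σ'_x Σ'_z [fxz]·W…`
  have e1 : ∀ (q u' : Site (d + 1)), ∑' x : Site (d + 1), ∑' z : Site (d + 1), dressKBmAt (toSite r) N (W κ q κ' u') x z (Sum.inl a) (Sum.inl b)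
      = (N : ℝ) ^ 2 * ∑' x : Site (d + 1), ∑' z : Site (d + 1), (if fxz x z then W κ q κ' u' x z (Sum.inl a) (Sum.inl b) else 0) :=
    fun q u' => tsum_tsum_dressKBmAt_inl_inl_eq_face hN hr (fun α' β' => summable_legs hWloc hδ κ q κ' u' (Sum.inl α') (Sum.inl β')) a b
  simp_rw [e1]
  -- STEP 2 (first source slot's window, pointwise): `Σ'_x Σ'_z [fxz]·W κ q κ′ u′ = coProjBmAt ρ N (β p ↦ Σ'_x Σ'_z [fxz]·V β p κ′ u′) κ q`
  have e2 : ∀ (q u' : Site (d + 1)), ∑' x : Site (d + 1), ∑' z : Site (d + 1), (if fxz x z then W κ q κ' u' x z (Sum.inl a) (Sum.inl b) else 0)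
      = coProjBmAt (toSite r) N (fun β p => ∑' x : Site (d + 1), ∑' z : Site (d + 1),
          (if fxz x z then V β p κ' u' x z (Sum.inl a) (Sum.inl b) else 0)) κ q :=
    fun q u' => tsum_tsum_face_coProjBmAtK (toSite r) N (Sum.inl a) (Sum.inl b)
      (S := fun κ₁ u₁ => V κ₁ u₁ κ' u') (fun β' u₂ => summable_legs hVloc hδ β' u₂ κ' u' (Sum.inl a) (Sum.inl b)) fxz κ q
  simp_rw [e2]
  -- STEP 3 (second bond sum through the first slot's finite window): `Σ'_{u′} coProjBmAt(...)(κ,q) = coProjBmAt ρ N (β p ↦ Σ'_{u′} Σ'_x Σ'_z [fxz]·V β p κ′ u′) κ q`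
  have hGsum : ∀ (β : Fin (d + 1)) (p : Site (d + 1)), Summable fun u' : Site (d + 1) =>
      ∑' x : Site (d + 1), ∑' z : Site (d + 1), (if fxz x z then V β p κ' u' x z (Sum.inl a) (Sum.inl b) else 0) :=
    fun β p => summable_faceSum hVloc hδ β p κ' (Sum.inl a) (Sum.inl b) fxz
  have e3 : ∀ q : Site (d + 1), ∑' u' : Site (d + 1), (N : ℝ) ^ 2 * coProjBmAt (toSite r) N (fun β p => ∑' x : Site (d + 1), ∑' z : Site (d + 1),
          (if fxz x z then V β p κ' u' x z (Sum.inl a) (Sum.inl b) else 0)) κ q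
      = (N : ℝ) ^ 2 * coProjBmAt (toSite r) N (fun β p => ∑' u' : Site (d + 1), ∑' x : Site (d + 1), ∑' z : Site (d + 1),
          (if fxz x z then V β p κ' u' x z (Sum.inl a) (Sum.inl b) else 0)) κ q := by
    intro q
    rw [tsum_mul_left]
    congr 1
    simp only [coProjBmAt_apply]
    have hs : ∀ v ∈ cube (d + 1) N, ∀ β : Fin (d + 1), Summable fun u' : Site (d + 1) => pmBm (toSite r) N β (q + v) κ q *
        ∑' x : Site (d + 1), ∑' z : Site (d + 1), (if fxz x z then V β (q + v) κ' u' x z (Sum.inl a) (Sum.inl b) else 0) :=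
      fun v _ β => (hGsum β (q + v)).mul_left _
    rw [Summable.tsum_finsetSum fun v hv => summable_sum fun β _ => hs v hv β]
    refine Finset.sum_congr rfl fun v hv => ?_
    rw [Summable.tsum_finsetSum fun β _ => hs v hv β]
    refine Finset.sum_congr rfl fun β _ => ?_
    rw [tsum_mul_left]
  simp_rw [e3]
  -- STEP 4 (second source slot read by its total): `Σ'_{u′} Σ'_x Σ'_z [fxz]·V β p κ′ u′ = N·Ψ β p`
  have e4 : ∀ (β : Fin (d + 1)) (p : Site (d + 1)), ∑' u' : Site (d + 1), ∑' x : Site (d + 1), ∑' z : Site (d + 1),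
        (if fxz x z then V β p κ' u' x z (Sum.inl a) (Sum.inl b) else 0) = (N : ℝ) * Ψ β p :=
    fun β p => tsum_faceSum_coProj_snd hN hr hY hδ β p κ' (Sum.inl a) (Sum.inl b) fxz
  simp_rw [e4]
  -- `coProjBmAt` is linear: pull the factor `N`
  have e5 : ∀ q : Site (d + 1), coProjBmAt (toSite r) N (fun β p => (N : ℝ) * Ψ β p) κ q = (N : ℝ) * coProjBmAt (toSite r) N Ψ κ q := by
    intro q
    simp only [coProjBmAt_apply, Finset.mul_sum]
    exact Finset.sum_congr rfl fun v _ => Finset.sum_congr rfl fun β _ => by ring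
  simp_rw [e5]
  -- STEP 5 (first source slot, one cell, periodic reduced one-form): `Σ_{r′} coProjBmAt ρ N Ψ κ (toSite r′) = N·Σ_{r′} [face]·Ψ κ (toSite r′)`
  have hper : ∀ (β : Fin (d + 1)) (q t : Site (d + 1)), Ψ β (q + (N : ℤ) • t) = Ψ β q :=
    fun β q t => faceSum_periodic N hcov κ' a b (Sum.inl a) (Sum.inl b) β q t
  rw [← Finset.mul_sum, ← Finset.mul_sum, sum_box_coProjBmAt_eq_face_of_periodic hN hr hper κ]
  -- STEP 6: collect the powers of `N` and merge the masks
  rw [show (N : ℝ) ^ 2 * ((N : ℝ) * ((N : ℝ) * ∑ r' ∈ box (d + 1) N, (if toSite r' κ % (N : ℤ) = (N : ℤ) - 1 then Ψ κ (toSite r') else 0)))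
      = (N : ℝ) ^ 4 * ∑ r' ∈ box (d + 1) N, (if toSite r' κ % (N : ℤ) = (N : ℤ) - 1 then Ψ κ (toSite r') else 0) by ring]
  congr 1
  refine Finset.sum_congr rfl fun r' _ => ?_
  rw [hΨ, ite_tsum]
  refine tsum_congr fun u' => ?_
  by_cases h1 : toSite r' κ % (N : ℤ) = (N : ℤ) - 1
  · rw [if_pos h1]
    by_cases h2 : u' κ' % (N : ℤ) = (N : ℤ) - 1
    · rw [if_pos h2]
      refine tsum_congr fun x => tsum_congr fun z => ?_
      by_cases h3 : fxz x z
      · rw [if_pos h3, if_pos ⟨h1, h2, h3⟩]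
      · rw [if_neg h3, if_neg (fun h => h3 h.2.2)]
    · rw [if_neg h2]
      symm
      rw [show (∑' x : Site (d + 1), ∑' z : Site (d + 1),
          (if toSite r' κ % (N : ℤ) = (N : ℤ) - 1 ∧ u' κ' % (N : ℤ) = (N : ℤ) - 1 ∧ fxz x z
            then Y κ (toSite r') κ' u' x z (Sum.inl a) (Sum.inl b) else 0))
          = ∑' x : Site (d + 1), ∑' z : Site (d + 1), (0 : ℝ) from
        tsum_congr fun x => tsum_congr fun z => if_neg (fun h => h2 h.2.1)]
      simp
  · rw [if_neg h1]
    symm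
    rw [show (∑' x : Site (d + 1), ∑' z : Site (d + 1),
        (if toSite r' κ % (N : ℤ) = (N : ℤ) - 1 ∧ u' κ' % (N : ℤ) = (N : ℤ) - 1 ∧ fxz x z
          then Y κ (toSite r') κ' u' x z (Sum.inl a) (Sum.inl b) else 0))
        = ∑' x : Site (d + 1), ∑' z : Site (d + 1), (0 : ℝ) from
      tsum_congr fun x => tsum_congr fun z => if_neg (fun h => h1 h.1)]
    simp

/-! ## §4 The (W3)(b) object: the zero mode of the dressing DEFECT `𝔇 Y − Y` -/

/-- NOT IN PRINT; OUR BOOKKEEPING.  **THE ZERO MODE OF THE DRESSING DEFECT** — the object of the owner's (W3)(b) (in-block root, `1 ≤ N`, `LocStencil₂ Y C δ`,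
`0 < δ`, jointly `N`-covariant `Y`): `zmode N (𝔇 Y − Y) κ κ′ (inl a) (inl b) = N⁴·fourFace − zmode N Y κ κ′ (inl a) (inl b)` (§3 + leaf-19's
`WSlotFirstDiff.zmode_sub`).  So `ZfreeSym Y` (which kills the second term, bond-symmetrised) leaves the bond-symmetrised FOUR-FACE charge of `Y` as the
charge of the defect: «`(𝔇 − 1)` adds no cell charge» holds for a given table iff its symmetrised four-face charge vanishes — a property of the TABLE. -/
theorem zmode_tableDress_sub_self_ff (hN : 1 ≤ N) (hr : r ∈ box (d + 1) N) {Y : Tab d} {C δ : ℝ} (hY : LocStencil₂ Y C δ) (hδ : 0 < δ)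
    (hcov : ∀ κ u κ' u' t, Y κ (u + (N : ℤ) • t) κ' (u' + (N : ℤ) • t) = shiftK (-((N : ℤ) • t)) (Y κ u κ' u'))
    (κ κ' a b : Fin (d + 1)) :
    zmode N (fun κ u κ' u' => dressKBmAt (toSite r) N
        (coProjBmAtK (toSite r) N (fun κ₁ u₁ => coProjBmAtK (toSite r) N (Y κ₁ u₁) κ' u') κ u) - Y κ u κ' u') κ κ' (Sum.inl a) (Sum.inl b)
      = (N : ℝ) ^ 4 * (∑ r' ∈ box (d + 1) N, ∑' u' : Site (d + 1), ∑' x : Site (d + 1), ∑' z : Site (d + 1),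
          (if toSite r' κ % (N : ℤ) = (N : ℤ) - 1 ∧ u' κ' % (N : ℤ) = (N : ℤ) - 1 ∧ x a % (N : ℤ) = (N : ℤ) - 1 ∧ z b % (N : ℤ) = (N : ℤ) - 1
            then Y κ (toSite r') κ' u' x z (Sum.inl a) (Sum.inl b) else 0))
        - zmode N Y κ κ' (Sum.inl a) (Sum.inl b) := by
  -- the dressed table is `LocStencil₂` at the same rate (leaf-06 g42∕g43's chain `_coProj_snd → _coProj_fst → _dress`; the NAMED statement is
  -- leaf-06 g43's `TableDressingDefect.locStencil₂_tableDress` — not re-declared here)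
  have hD : LocStencil₂ (fun κ u κ₂ u₂ => dressKBmAt (toSite r) N
      (coProjBmAtK (toSite r) N (fun κ₁ u₁ => coProjBmAtK (toSite r) N (Y κ₁ u₁) κ₂ u₂) κ u))
      (cKb d N δ * cKb d N δ * (cWb d N * Real.exp (3 * δ * (((d : ℝ) + 1) * N)) * (cKb d N δ * C))) δ :=
    locStencil₂_dress hN hr (locStencil₂_coProj_fst hN hr (locStencil₂_coProj_snd hN hr hY hδ.le) hδ.le) hδ.le
  have h := zmode_sub (N := N) hD hY hδ κ κ' (Sum.inl a) (Sum.inl b)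
  rw [zmode_tableDress_ff hN hr hY hδ hcov κ κ' a b] at h
  exact h

end Summit.QuantumFields.BalabanUV.Beta.GAN24.TableDressingZeroMode

end
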